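import Mathlib
import Summits.MatrixMultiplication.MatrixMultiplication.Theses.FourierTwoFamiliesModP
import Literature.Computability.AlgebraicComplexity.SimultaneousDoubleProduct
import Summits.MatrixMultiplication.MatrixMultiplication.Theorems.FourierTwoFamiliesModPPowerGainRefutes
import Summits.MatrixMultiplication.MatrixMultiplication.Theorems.FourierTwoFamiliesModPPrimeTwoFamiliesCapacityEquivalences

/-!
# The single-scale kill criterion for `PrimeTwoFamilies`: co-volume form and BALANCED form
# (crux stmt-MatrixMultiplication-14308 `FourierTwoFamiliesModP.PrimeTwoFamilies`, line `Sketch`)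

`FourierTwoFamiliesModP.PrimeTwoFamilies` is CKSU 2005 Conj. 4.7 with prime cyclic hosts: for every
`δ > 0` and arbitrarily large `n`, a prime `p ≤ n^{2+δ}` and `n` pairs `(A_i, B_i)` in `ℤ/p` with the
simultaneous double product property ((W), (X) of CKSU Def. 4.1, inlined) and `|A_i||B_i| ≥ n^{2-δ}`.

* (input, from the tree) `CapacityLift.primeTwoFamilies_false_of_singleScaleDefect` — the single-scale kill
  criterion in co-volume form: a power defect `n ≤ p^{1-γ/2-c}` for SDPP families of co-volume `≥ p^γ` in all
  large prime cyclic groups, at ONE scale `γ ∈ (0,1)`, refutes the crux.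
* `exists_balanced_subfamily` — CKSU's balancing step made reusable (any finite abelian group): an SDPP
  family of `n` pairs with co-volumes `≥ P > 0` contains, after Markov on the two packings
  `Σ|A_i|, Σ|B_i| ≤ |G|` and shrinking, a BALANCED SDPP family (`|A'_j| = |B'_j| = s`) of `m ≥ n/2` pairs,
  for every `s` with `4 s |G| ≤ P n`.
* `singleScaleDefect_of_balancedDefect` — a power defect for BALANCED families at ONE size scale
  (`p^σ ≤ s ≤ 2 p^σ`, `n ≤ p^{1-σ-c}`) gives the co-volume defect at scale `γ = 2σ + c` with exponent `c/4`.
* `primeTwoFamilies_false_of_balancedSingleScaleDefect` — hence the BALANCED SINGLE-SCALE KILL CRITERION: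
  for `σ ∈ [0, 1/2)` and `c > 0`, if for all primes `p ≥ p₀` every balanced SDPP family in `ZMod p` whose
  common class size `s` lies in the window `[p^σ, 2 p^σ]` has `n ≤ p^{1-σ-c}` pairs, the crux is false.
  This is the common generalisation of the route's proved kill link `PowerGainRefutes`
  (`PrimeCyclicPowerGain`: `n s^{1+c} ≤ p` at ALL sizes `s ≥ s₀`; at `σ = 1/4` it is a balanced defect
  with exponent `c/4`) and of the co-volume criterion above, in the vocabulary of the route's open kill
  items (`PrimeCyclicPowerGain`, `PrimeLogDecay`, `PrimeDensityDecay` all quantify over balanced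
  configurations `|A_i| = |B_i| = s`): the disprover may fix ONE size scale `s ≈ p^σ` of its choosing.

Design: no new `Prop` definitions (hypotheses inlined in the route's clause order); the balancing lemma is
stated for `IsSDPP` (`isSDPP_iff` is `Iff.rfl` against the inlined clauses) over an arbitrary finite additive
abelian group so that the all-abelian-hosts side can reuse it.  The co-volume criterion itself is NOT restated
here (it is the tree's `CapacityLift.primeTwoFamilies_false_of_singleScaleDefect`, review of p113403).  The
namespace `Summit.MatrixMultiplication.MatrixMultiplication.…` (summit = sub-problem for this single-conjunct
summit, CONVENTIONS §1–2) is mandated, which forces `linter.dupNamespace` off as in every Theorems file of this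
problem.
-/

-- single-conjunct summit: the mandated namespace repeats `MatrixMultiplication` (summit = sub-problem).
set_option linter.dupNamespace false

namespace Summit.MatrixMultiplication.MatrixMultiplication.Theorems.PrimeTwoFamilies.SingleScaleDefectK3

open Finset
open Summit.MatrixMultiplication.MatrixMultiplication.Theses
open Literature.Computability.AlgebraicComplexity

/-- **Balancing an SDPP family** (the Markov-and-shrink step of CKSU 2005 Prop. 4.6 / the route's
`PowerGainRefutes`, made reusable).  Let `(A i, B i)_{i<n}` be an SDPP family in a finite additive abelian
group `G` with all co-volumes `|A i| |B i| ≥ P > 0`, and let `s` satisfy `4 s |G| ≤ P n`.  All classes are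
non-empty, so the `A i` are pairwise disjoint and so are the `B i` (`Σ|A i|, Σ|B i| ≤ |G|`); by Markov at
most `n/4` indices have `|A i| n > 4|G|`, likewise for `B`, so `m ≥ n/2` indices are good, and a good index
has `|B i| ≥ P n / (4|G|) ≥ s` and `|A i| ≥ s`.  Reindexing the good pairs by `Fin m` (`IsSDPP.reindex`)
and shrinking both sides to exactly `s` elements (`IsSDPP.mono`) gives a BALANCED SDPP family of `m` pairs
with `n ≤ 2 m`. [folklore] -/
theorem exists_balanced_subfamily {G : Type*} [AddCommGroup G] [Fintype G] {n : ℕ}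
    {A B : Fin n → Finset G} (hS : IsSDPP A B) {P s : ℕ} (hP0 : 0 < P)
    (hP : ∀ i : Fin n, P ≤ (A i).card * (B i).card)
    (hs : s * (4 * Fintype.card G) ≤ P * n) :
    ∃ (m : ℕ) (A' B' : Fin m → Finset G), IsSDPP A' B' ∧
      (∀ j : Fin m, (A' j).card = s ∧ (B' j).card = s) ∧ n ≤ 2 * m := by
  classical
  set N : ℕ := Fintype.card G with hN
  -- non-emptiness and the packings `Σ|A i| ≤ |G|`, `Σ|B i| ≤ |G|`
  have hne : ∀ i : Fin n, (A i).Nonempty ∧ (B i).Nonempty := by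
    intro i
    have h1 : 0 < (A i).card * (B i).card := hP0.trans_le (hP i)
    refine ⟨Finset.card_pos.1 (Nat.pos_of_ne_zero fun h0 => ?_),
      Finset.card_pos.1 (Nat.pos_of_ne_zero fun h0 => ?_)⟩
    · rw [h0, zero_mul] at h1; exact lt_irrefl 0 h1
    · rw [h0, mul_zero] at h1; exact lt_irrefl 0 h1
  have hsumA : ∑ i, (A i).card ≤ N := hS.sum_card_left_le fun i => (hne i).2
  have hsumB : ∑ i, (B i).card ≤ N := hS.sum_card_right_le fun i => (hne i).1
  -- the good indices: `|A i| n ≤ 4|G|` and `|B i| n ≤ 4|G|`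
  set good := (Finset.univ : Finset (Fin n)).filter
    (fun i => (A i).card * n ≤ 4 * N ∧ (B i).card * n ≤ 4 * N) with hgood
  have hbadA := powerGainRefutes_four_mul_card_filter_le (fun i => (A i).card) hsumA
  have hbadB := powerGainRefutes_four_mul_card_filter_le (fun i => (B i).card) hsumB
  have hgood_card : n ≤ 2 * good.card := by
    -- the complement of `good` lies in `badA ∪ badB`
    have hsub : (Finset.univ : Finset (Fin n)) ⊆ good ∪
        ((Finset.univ : Finset (Fin n)).filter (fun i => 4 * N < (A i).card * n) ∪
         (Finset.univ : Finset (Fin n)).filter (fun i => 4 * N < (B i).card * n)) := by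
      intro i _
      by_cases hA : (A i).card * n ≤ 4 * N
      · by_cases hB : (B i).card * n ≤ 4 * N
        · exact Finset.mem_union_left _ (Finset.mem_filter.2 ⟨Finset.mem_univ _, hA, hB⟩)
        · exact Finset.mem_union_right _ (Finset.mem_union_right _
            (Finset.mem_filter.2 ⟨Finset.mem_univ _, not_le.1 hB⟩))
      · exact Finset.mem_union_right _ (Finset.mem_union_left _
          (Finset.mem_filter.2 ⟨Finset.mem_univ _, not_le.1 hA⟩))
    have h1 := Finset.card_le_card hsub
    rw [Finset.card_univ, Fintype.card_fin] at h1
    have h2 : (good ∪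
        ((Finset.univ : Finset (Fin n)).filter (fun i => 4 * N < (A i).card * n) ∪
         (Finset.univ : Finset (Fin n)).filter (fun i => 4 * N < (B i).card * n))).card ≤
        good.card + (((Finset.univ : Finset (Fin n)).filter (fun i => 4 * N < (A i).card * n)).card +
          ((Finset.univ : Finset (Fin n)).filter (fun i => 4 * N < (B i).card * n)).card) :=
      (Finset.card_union_le _ _).trans (Nat.add_le_add_left (Finset.card_union_le _ _) _)
    have h3 := h1.trans h2
    omega
  -- on a good index both sides have at least `s` elements: `4 s |G| ≤ P n ≤ |A i| |B i| n ≤ 4 |G| |B i|`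
  have hkey : ∀ i ∈ good, s ≤ (A i).card ∧ s ≤ (B i).card := by
    intro i hi
    obtain ⟨-, hA4, hB4⟩ := Finset.mem_filter.1 hi
    obtain ⟨a, ha⟩ := (hne i).1
    have hNpos : 0 < 4 * N := Nat.mul_pos (by norm_num) (Fintype.card_pos_iff.2 ⟨a⟩)
    refine ⟨le_of_mul_le_mul_right ?_ hNpos, le_of_mul_le_mul_right ?_ hNpos⟩
    · calc s * (4 * N) ≤ P * n := hs
        _ ≤ (A i).card * (B i).card * n := Nat.mul_le_mul_right _ (hP i)
        _ = (A i).card * ((B i).card * n) := by ring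
        _ ≤ (A i).card * (4 * N) := Nat.mul_le_mul_left _ hB4
    · calc s * (4 * N) ≤ P * n := hs
        _ ≤ (A i).card * (B i).card * n := Nat.mul_le_mul_right _ (hP i)
        _ = (B i).card * ((A i).card * n) := by ring
        _ ≤ (B i).card * (4 * N) := Nat.mul_le_mul_left _ hA4
  -- reindex the good pairs by `Fin m` and shrink both sides to exactly `s` elements
  set m : ℕ := good.card with hm
  let ι : Fin m → Fin n := fun j => (good.equivFin.symm j).1
  have hιmem : ∀ j, ι j ∈ good := fun j => (good.equivFin.symm j).2
  have hιinj : Function.Injective ι := fun j j' hj =>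
    good.equivFin.symm.injective (Subtype.ext hj)
  have hA' : ∀ j : Fin m, ∃ A' : Finset G, A' ⊆ A (ι j) ∧ A'.card = s :=
    fun j => Finset.exists_subset_card_eq (hkey _ (hιmem j)).1
  have hB' : ∀ j : Fin m, ∃ B' : Finset G, B' ⊆ B (ι j) ∧ B'.card = s :=
    fun j => Finset.exists_subset_card_eq (hkey _ (hιmem j)).2
  choose A' hA'sub hA'card using hA'
  choose B' hB'sub hB'card using hB'
  exact ⟨m, A', B', (hS.reindex ι hιinj).mono hA'sub hB'sub, fun j => ⟨hA'card j, hB'card j⟩,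
    hgood_card⟩

/-- **A balanced defect at one size scale gives a co-volume defect at one scale.**  Suppose that for all
primes `p ≥ p₀` every BALANCED SDPP family in `ZMod p` (`|A i| = |B i| = s` for all `i`, clauses (W), (X))
whose class size lies in the window `p ^ σ ≤ s ≤ 2 p ^ σ` has `n ≤ p ^ (1 - σ - c)` pairs (`0 ≤ σ`,
`0 < c`).  Then for all large primes `p` every SDPP family with all co-volumes `≥ p ^ (2σ + c)` has
`n ≤ p ^ (1 - (2σ + c)/2 - c/4)` (`= p ^ (1 - σ - 3c/4)`) pairs.  Indeed, if `n` were larger, balancing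
(`exists_balanced_subfamily` with `s := ⌈p ^ σ⌉₊ ≤ 2 p ^ σ`, admissible because
`4 s p ≤ 8 p ^ (1+σ) ≤ p ^ (c/4) p ^ (1+σ) = p ^ (2σ+c) p ^ (1-σ-3c/4) < P n` once `p ^ (c/4) ≥ 8`) yields a
balanced family of `m ≥ n/2` pairs of size `s` in the window, so `n ≤ 2 m ≤ 2 p ^ (1-σ-c) ≤ p ^ (1-σ-3c/4)`,
a contradiction. -/
theorem singleScaleDefect_of_balancedDefect {σ c : ℝ} (hσ : 0 ≤ σ) (hc : 0 < c)
    (h : ∃ p₀ : ℕ, ∀ p : ℕ, p.Prime → p₀ ≤ p → ∀ (n s : ℕ) (A B : Fin n → Finset (ZMod p)),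
      (p : ℝ) ^ σ ≤ (s : ℝ) → (s : ℝ) ≤ 2 * (p : ℝ) ^ σ →
      (∀ i : Fin n, (A i).card = s ∧ (B i).card = s) →
      (∀ i : Fin n, ∀ a ∈ A i, ∀ a' ∈ A i, ∀ b ∈ B i, ∀ b' ∈ B i,
          (a - a') + (b - b') = 0 → a = a' ∧ b = b') →
      (∀ i j k : Fin n, ∀ a ∈ A i, ∀ a' ∈ A j, ∀ b ∈ B j, ∀ b' ∈ B k,
          (a - a') + (b - b') = 0 → i = k) →
      (n : ℝ) ≤ (p : ℝ) ^ (1 - σ - c)) :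
    ∃ p₁ : ℕ, ∀ p : ℕ, p.Prime → p₁ ≤ p → ∀ (n : ℕ) (A B : Fin n → Finset (ZMod p)),
      (∀ i : Fin n, ∀ a ∈ A i, ∀ a' ∈ A i, ∀ b ∈ B i, ∀ b' ∈ B i,
          (a - a') + (b - b') = 0 → a = a' ∧ b = b') →
      (∀ i j k : Fin n, ∀ a ∈ A i, ∀ a' ∈ A j, ∀ b ∈ B j, ∀ b' ∈ B k,
          (a - a') + (b - b') = 0 → i = k) →
      (∀ i : Fin n, (p : ℝ) ^ (2 * σ + c) ≤ (((A i).card * (B i).card : ℕ) : ℝ)) →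
      (n : ℝ) ≤ (p : ℝ) ^ (1 - (2 * σ + c) / 2 - c / 4) := by
  classical
  obtain ⟨p₀, hp₀⟩ := h
  -- threshold: `p ≥ p₀`, `p ≥ 2`, and `p ≥ 8 ^ (4/c)` (so that `p ^ (c/4) ≥ 8`)
  set T : ℕ := ⌈(8 : ℝ) ^ (4 / c)⌉₊ with hT
  refine ⟨max p₀ (max 2 T), fun p hprime hp n A B hW hX hcov => ?_⟩
  have hp₀p : p₀ ≤ p := (le_max_left _ _).trans hp
  have hp2 : 2 ≤ p := ((le_max_left _ _).trans (le_max_right _ _)).trans hp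
  have hpT : T ≤ p := ((le_max_right _ _).trans (le_max_right _ _)).trans hp
  have hp0 : (0 : ℝ) < p := by exact_mod_cast (show 0 < p by omega)
  have hp1 : (1 : ℝ) ≤ p := by exact_mod_cast (show 1 ≤ p by omega)
  have h8 : (8 : ℝ) ≤ (p : ℝ) ^ (c / 4) := by
    have h1 : (8 : ℝ) ^ (4 / c) ≤ p := (Nat.le_ceil _).trans (by exact_mod_cast hpT)
    have h2 := Real.rpow_le_rpow (by positivity) h1 (by positivity : (0 : ℝ) ≤ c / 4)
    rwa [← Real.rpow_mul (by norm_num : (0 : ℝ) ≤ 8), div_mul_div_comm, mul_comm 4 c,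
      div_self (by positivity : (c * 4 : ℝ) ≠ 0), Real.rpow_one] at h2
  by_contra hlt
  rw [not_le] at hlt
  -- the natural-number co-volume bound and the target size
  set P : ℕ := ⌈(p : ℝ) ^ (2 * σ + c)⌉₊ with hPdef
  have hP0 : 0 < P := Nat.ceil_pos.2 (Real.rpow_pos_of_pos hp0 _)
  have hPi : ∀ i : Fin n, P ≤ (A i).card * (B i).card := fun i => Nat.ceil_le.2 (hcov i)
  have hPr : (p : ℝ) ^ (2 * σ + c) ≤ P := Nat.le_ceil _
  set s : ℕ := ⌈(p : ℝ) ^ σ⌉₊ with hsdef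
  have hσ1 : (1 : ℝ) ≤ (p : ℝ) ^ σ := Real.one_le_rpow hp1 hσ
  have hs1 : (p : ℝ) ^ σ ≤ s := Nat.le_ceil _
  have hs2 : (s : ℝ) ≤ 2 * (p : ℝ) ^ σ := by
    have := Nat.ceil_lt_add_one (zero_le_one.trans hσ1)
    rw [← hsdef] at this
    linarith
  -- admissibility of `s`: `4 s p ≤ P n`
  have hsPn : (s : ℝ) * (4 * (p : ℝ)) ≤ (P : ℝ) * n := by
    have e1 : (p : ℝ) ^ (c / 4) * ((p : ℝ) * (p : ℝ) ^ σ) =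
        (p : ℝ) ^ (2 * σ + c) * (p : ℝ) ^ (1 - (2 * σ + c) / 2 - c / 4) := by
      rw [← Real.rpow_add hp0]
      nth_rw 2 [← Real.rpow_one (p : ℝ)]
      rw [← Real.rpow_add hp0, ← Real.rpow_add hp0]
      congr 1; ring
    calc (s : ℝ) * (4 * (p : ℝ)) ≤ 2 * (p : ℝ) ^ σ * (4 * (p : ℝ)) :=
          mul_le_mul_of_nonneg_right hs2 (by positivity)
      _ = 8 * ((p : ℝ) * (p : ℝ) ^ σ) := by ring
      _ ≤ (p : ℝ) ^ (c / 4) * ((p : ℝ) * (p : ℝ) ^ σ) :=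
          mul_le_mul_of_nonneg_right h8 (by positivity)
      _ = (p : ℝ) ^ (2 * σ + c) * (p : ℝ) ^ (1 - (2 * σ + c) / 2 - c / 4) := e1
      _ ≤ (P : ℝ) * n := mul_le_mul hPr hlt.le (by positivity) (by positivity)
  haveI : Fact p.Prime := ⟨hprime⟩
  have hs : s * (4 * Fintype.card (ZMod p)) ≤ P * n := by
    rw [ZMod.card]
    exact_mod_cast hsPn
  -- balance, then apply the balanced defect
  obtain ⟨m, A', B', hS', hbal, hnm⟩ := exists_balanced_subfamily ⟨hW, hX⟩ hP0 hPi hs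
  have hm : (m : ℝ) ≤ (p : ℝ) ^ (1 - σ - c) := hp₀ p hprime hp₀p m s A' B' hs1 hs2 hbal hS'.1 hS'.2
  have hnm' : (n : ℝ) ≤ 2 * m := by exact_mod_cast hnm
  -- `n ≤ 2 m ≤ 2 p ^ (1-σ-c) ≤ p ^ (c/4) p ^ (1-σ-c) = p ^ (1-σ-3c/4) < n`
  have e2 : (p : ℝ) ^ (c / 4) * (p : ℝ) ^ (1 - σ - c) = (p : ℝ) ^ (1 - (2 * σ + c) / 2 - c / 4) := by
    rw [← Real.rpow_add hp0]
    congr 1; ring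
  have hfin : (n : ℝ) ≤ (p : ℝ) ^ (1 - (2 * σ + c) / 2 - c / 4) :=
    calc (n : ℝ) ≤ 2 * m := hnm'
      _ ≤ 2 * (p : ℝ) ^ (1 - σ - c) := by linarith
      _ ≤ (p : ℝ) ^ (c / 4) * (p : ℝ) ^ (1 - σ - c) :=
          mul_le_mul_of_nonneg_right (by linarith) (by positivity)
      _ = (p : ℝ) ^ (1 - (2 * σ + c) / 2 - c / 4) := e2
  exact absurd hfin (not_le.2 hlt)

/-- **BALANCED SINGLE-SCALE KILL CRITERION.**  Let `0 ≤ σ < 1/2` and `c > 0`.  If for all primes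
`p ≥ p₀` every balanced SDPP family in `ZMod p` — `n` pairs `(A i, B i)` with `|A i| = |B i| = s`,
clauses (W), (X) of CKSU 2005 Def. 4.1 — whose class size lies in the window `p ^ σ ≤ s ≤ 2 p ^ σ` has
at most `n ≤ p ^ (1 - σ - c)` pairs, then `PrimeTwoFamilies` (CKSU 2005 Conj. 4.7, prime cyclic hosts)
is false.  Proof: shrink `c` to `c' := min c ((1 - 2σ)/2)` (a defect persists under shrinking, for
`p ≥ 1`), convert to the co-volume defect at scale `γ := 2σ + c' < 1`
(`singleScaleDefect_of_balancedDefect`) and apply `CapacityLift.primeTwoFamilies_false_of_singleScaleDefect`.  The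
packing-tight value at size scale `σ` is `n = p ^ (1 - σ - o(1))`; the route's `PowerGainRefutes` is the
case of a defect at all sizes at once. -/
theorem primeTwoFamilies_false_of_balancedSingleScaleDefect {σ c : ℝ} (hσ : 0 ≤ σ) (hσ2 : σ < 1 / 2)
    (hc : 0 < c)
    (h : ∃ p₀ : ℕ, ∀ p : ℕ, p.Prime → p₀ ≤ p → ∀ (n s : ℕ) (A B : Fin n → Finset (ZMod p)),
      (p : ℝ) ^ σ ≤ (s : ℝ) → (s : ℝ) ≤ 2 * (p : ℝ) ^ σ →
      (∀ i : Fin n, (A i).card = s ∧ (B i).card = s) →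
      (∀ i : Fin n, ∀ a ∈ A i, ∀ a' ∈ A i, ∀ b ∈ B i, ∀ b' ∈ B i,
          (a - a') + (b - b') = 0 → a = a' ∧ b = b') →
      (∀ i j k : Fin n, ∀ a ∈ A i, ∀ a' ∈ A j, ∀ b ∈ B j, ∀ b' ∈ B k,
          (a - a') + (b - b') = 0 → i = k) →
      (n : ℝ) ≤ (p : ℝ) ^ (1 - σ - c)) :
    ¬ FourierTwoFamiliesModP.PrimeTwoFamilies := by
  -- shrink the defect exponent so that the co-volume scale `2σ + c'` stays below `1`
  set c' : ℝ := min c ((1 - 2 * σ) / 2) with hc'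
  have hc'pos : 0 < c' := lt_min hc (by linarith)
  have hc'c : c' ≤ c := min_le_left _ _
  have hγ1 : 2 * σ + c' < 1 := by
    have := min_le_right c ((1 - 2 * σ) / 2)
    linarith
  have h' : ∃ p₀ : ℕ, ∀ p : ℕ, p.Prime → p₀ ≤ p → ∀ (n s : ℕ) (A B : Fin n → Finset (ZMod p)),
      (p : ℝ) ^ σ ≤ (s : ℝ) → (s : ℝ) ≤ 2 * (p : ℝ) ^ σ →
      (∀ i : Fin n, (A i).card = s ∧ (B i).card = s) →
      (∀ i : Fin n, ∀ a ∈ A i, ∀ a' ∈ A i, ∀ b ∈ B i, ∀ b' ∈ B i,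
          (a - a') + (b - b') = 0 → a = a' ∧ b = b') →
      (∀ i j k : Fin n, ∀ a ∈ A i, ∀ a' ∈ A j, ∀ b ∈ B j, ∀ b' ∈ B k,
          (a - a') + (b - b') = 0 → i = k) →
      (n : ℝ) ≤ (p : ℝ) ^ (1 - σ - c') := by
    obtain ⟨p₀, hp₀⟩ := h
    refine ⟨max p₀ 1, fun p hp hp₀p n s A B hs1 hs2 hbal hW hX => ?_⟩
    have hp1 : (1 : ℝ) ≤ p := by exact_mod_cast (le_max_right p₀ 1).trans hp₀p
    exact (hp₀ p hp ((le_max_left _ _).trans hp₀p) n s A B hs1 hs2 hbal hW hX).trans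
      (Real.rpow_le_rpow_of_exponent_le hp1 (by linarith))
  exact CapacityLift.primeTwoFamilies_false_of_singleScaleDefect (γ := 2 * σ + c') (c := c' / 4)
    (by linarith) hγ1
    (by linarith) (singleScaleDefect_of_balancedDefect hσ hc'pos h')

end Summit.MatrixMultiplication.MatrixMultiplication.Theorems.PrimeTwoFamilies.SingleScaleDefectK3
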